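import Summits.Ventures.HodgeRepro2.T5FockWeights

/-!
# T5FockFFT — the first fundamental theorem for `U(3)` on `ℂ[w_{i,1}, w_{i,2}]`: the invariants are
# `ℂ[Q]` (blind cell pub-hodge-repro2; support for route/T5-N4-p5.md, N4.3 = (R3), step (P2-bis))

`T5FockWeights.unitaryAct_Q` is the easy half («`Q` is invariant»). This file proves the HARD half
of N4.3's honest-scope item (l. 117) «the first fundamental theorem `U(3)`-invariants = `ℂ[Q]`»:
every `f ∈ MvPolynomial Var ℂ` (`Var = Fin 3 × Fin 2`; the action `unitaryAct u` is `std*` on the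
first column and `std` on the second) fixed by every unitary `u` is a polynomial in
`Q = ∑ᵢ X(i,0) X(i,1)` (`invariant_eq_aeval_Q`).

**Proof (elementary; no density / unitarian trick).**
1. TORUS. For a diagonal unitary `diag t` the action multiplies the monomial `X^d` by
   `∏ᵢ (star tᵢ)^{d(i,0)} tᵢ^{d(i,1)}` (`coeff_unitaryAct_diagonal`). Invariance under all
   `diag t` with `|tᵢ| = 1` forces every monomial of `f` to be BALANCED, `d(i,0) = d(i,1)`
   (a primitive root of unity of order `d(i,0) + d(i,1) + 1` separates them), so
   `f = prodSubst F` with `prodSubst : ℂ[Z₀, Z₁, Z₂] → ℂ[Var]`, `Zᵢ ↦ X(i,0) X(i,1)` (`exists_balanced_of_torus`).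
2. MIXING. The Gaussian unitary `u = ½ !![1+i, 1−i; 1−i, 1+i] ⊕ 1` sends the point
   `z = (x(i,0) x(i,1))ᵢ` to `(½(z₀+z₁) + (i/2) y, ½(z₀+z₁) − (i/2) y, z₂)` with
   `y = x(1,0) x(0,1) − x(0,0) x(1,1)`; every `(w₀, w₁, w₂)` is realised by a point with `y = 0`
   (a square root), so `F̂(w₀, w₁, w₂) = F̂(½(w₀+w₁), ½(w₀+w₁), w₂)` for all `w` (`eval_mixing`).
3. SYMMETRY. The transposition `(1 2)` gives `F̂(w₀, w₁, w₂) = F̂(w₀, w₂, w₁)` (`eval_swap`).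
4. From 2 and 3: `F̂(w₀, w₁, w₂) = F̂(s/2, s/2, 0)`, `s = w₀ + w₁ + w₂`; with
   `C(T) := F(T/2, T/2, 0) ∈ ℂ[T]` and `MvPolynomial.funext`, `f = C(Q)`.

Honest scope: `U(3)` is `Matrix.unitaryGroup (Fin 3) ℂ` (`u uᴴ = 1`); the action is the one of
`T5FockWeights`; nothing is said about the Weil representation or the 𝔭-operators ([KK07] / R3.17,
printed). Mathlib + own prefix; no sorry; axioms ⊆ {propext, Classical.choice, Quot.sound}.
-/

namespace Summit.Ventures.HodgeRepro2.T5FockFFT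

open MvPolynomial Matrix
open T5FockInvariants T5FockWeights

/-! ## 1. The torus: coefficients of `unitaryAct (diagonal t)` -/

/-- The scalar by which `diag t` multiplies the monomial `X^d`:
`∏ᵢ (star tᵢ)^{d(i,0)} · tᵢ^{d(i,1)}`. -/
def torusScale (t : Fin 3 → ℂ) (d : Var →₀ ℕ) : ℂ :=
  d.prod fun p k => (if p.2 = 0 then star (t p.1) else t p.1) ^ k

/-- `unitaryAct (diagonal t)` is the substitution `X p ↦ c_p X p`. -/
theorem unitaryAct_diagonal (t : Fin 3 → ℂ) :
    unitaryAct (Matrix.diagonal t) =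
      aeval fun p : Var => C (if p.2 = 0 then star (t p.1) else t p.1) * X p := by
  unfold unitaryAct
  congr 1
  funext p
  split_ifs with h
  · rw [Finset.sum_eq_single p.1]
    · have hp : (p.1, (0 : Fin 2)) = p := Prod.ext rfl h.symm
      simp [Matrix.diagonal_apply_eq, hp]
    · intro j _ hj
      simp [Matrix.diagonal_apply_ne _ hj]
    · intro habs; exact absurd (Finset.mem_univ _) habs
  · rw [Finset.sum_eq_single p.1]
    · have h1 : p.2 = 1 := by omega
      have hp : (p.1, (1 : Fin 2)) = p := Prod.ext rfl h1.symm
      simp [Matrix.diagonal_apply_eq, hp]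
    · intro j _ hj
      simp [Matrix.diagonal_apply_ne _ hj]
    · intro habs; exact absurd (Finset.mem_univ _) habs

/-- The monomial formula for the torus action. -/
theorem unitaryAct_diagonal_monomial (t : Fin 3 → ℂ) (d : Var →₀ ℕ) (c : ℂ) :
    unitaryAct (Matrix.diagonal t) (monomial d c) = C (torusScale t d) * monomial d c := by
  rw [unitaryAct_diagonal, aeval_monomial, torusScale, monomial_eq]
  simp only [algebraMap_eq, mul_pow, ← C_pow, Finsupp.prod, Finset.prod_mul_distrib, map_prod]
  ring

/-- The coefficient formula for the torus action. -/
theorem coeff_unitaryAct_diagonal (t : Fin 3 → ℂ) (f : MvPolynomial Var ℂ) (d : Var →₀ ℕ) :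
    coeff d (unitaryAct (Matrix.diagonal t) f) = torusScale t d * coeff d f := by
  induction f using MvPolynomial.induction_on' with
  | monomial u a =>
    rw [unitaryAct_diagonal_monomial, coeff_C_mul, coeff_monomial]
    split_ifs with h
    · subst h; rfl
    · simp
  | add p q hp hq =>
    rw [map_add, coeff_add, coeff_add, hp, hq, mul_add]


/-! ## 2. Torus invariance forces balanced monomials; `f = prodSubst F` -/

/-- `diag t` is unitary when every `tᵢ t̄ᵢ = 1`. -/
theorem diagonal_unitary (t : Fin 3 → ℂ) (ht : ∀ i, t i * star (t i) = 1) :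
    Matrix.diagonal t * (Matrix.diagonal t)ᴴ = 1 := by
  rw [Matrix.diagonal_conjTranspose, Matrix.diagonal_mul_diagonal, ← Matrix.diagonal_one]
  congr 1
  funext i
  exact ht i

/-- The torus scale for `t = (1, …, ζ, …, 1)` (`ζ` at `i`). -/
theorem torusScale_update (i : Fin 3) (ζ : ℂ) (d : Var →₀ ℕ) :
    torusScale (Function.update (fun _ : Fin 3 => (1 : ℂ)) i ζ) d =
      (star ζ) ^ d (i, 0) * ζ ^ d (i, 1) := by
  rw [torusScale, Finsupp.prod_fintype _ _ (fun _ => pow_zero _), Fintype.prod_prod_type,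
    Finset.prod_eq_single i]
  · rw [Fin.prod_univ_two]
    simp
  · intro j _ hj
    rw [Fin.prod_univ_two]
    simp [Function.update_of_ne hj]
  · intro habs; exact absurd (Finset.mem_univ _) habs

/-- A root of unity of order `a + b + 1` separates unbalanced exponents `a ≠ b`. -/
theorem exists_unit_scale_ne_one (a b : ℕ) (hab : a ≠ b) :
    ∃ ζ : ℂ, ζ * star ζ = 1 ∧ (star ζ) ^ a * ζ ^ b ≠ 1 := by
  set n : ℕ := a + b + 1 with hn
  have hn0 : n ≠ 0 := by omega
  have hprim := Complex.isPrimitiveRoot_exp n hn0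
  set ζ := Complex.exp (2 * Real.pi * Complex.I / n) with hζ
  have hnorm : ‖ζ‖ = 1 := hprim.norm'_eq_one hn0
  have hunit : ζ * star ζ = 1 := by
    rw [Complex.star_def, Complex.mul_conj, Complex.normSq_eq_norm_sq, hnorm]
    simp
  refine ⟨ζ, hunit, fun h1 => ?_⟩
  have hζ0 : ζ ≠ 0 := by
    intro h0; rw [h0, zero_mul] at hunit; exact zero_ne_one hunit
  have hstar : star ζ = ζ⁻¹ := eq_inv_of_mul_eq_one_right hunit
  rw [hstar, inv_pow, ← zpow_natCast, ← zpow_natCast, ← _root_.zpow_neg, ← zpow_add₀ hζ0] at h1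
  have hdvd := (hprim.zpow_eq_one_iff_dvd _).1 h1
  have h0 : -(a : ℤ) + b = 0 := by
    refine Int.eq_zero_of_abs_lt_dvd hdvd ?_
    rw [hn]
    push_cast
    rw [abs_lt]
    constructor <;> omega
  omega

/-- Invariance under the diagonal unitaries forces every monomial of `f` to be balanced. -/
theorem balanced_of_torus (f : MvPolynomial Var ℂ)
    (hf : ∀ t : Fin 3 → ℂ, (∀ i, t i * star (t i) = 1) → unitaryAct (Matrix.diagonal t) f = f)
    (d : Var →₀ ℕ) (hd : coeff d f ≠ 0) (i : Fin 3) : d (i, 0) = d (i, 1) := by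
  by_contra hne
  obtain ⟨ζ, hζ, hne1⟩ := exists_unit_scale_ne_one (d (i, 0)) (d (i, 1)) hne
  set t := Function.update (fun _ : Fin 3 => (1 : ℂ)) i ζ with ht
  have htu : ∀ j, t j * star (t j) = 1 := by
    intro j
    by_cases hj : j = i
    · subst hj; simpa [ht] using hζ
    · simp [ht, Function.update_of_ne hj]
  have h := congrArg (coeff d) (hf t htu)
  rw [coeff_unitaryAct_diagonal, ht, torusScale_update] at h
  have h' : ((star ζ) ^ d (i, 0) * ζ ^ d (i, 1) - 1) * coeff d f = 0 := by
    rw [sub_mul, h, one_mul, sub_self]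
  rcases mul_eq_zero.1 h' with h0 | h0
  · exact hne1 (sub_eq_zero.1 h0)
  · exact hd h0

/-- `prodSubst : ℂ[Z₀, Z₁, Z₂] → ℂ[Var]`, `Zᵢ ↦ X(i,0) X(i,1)`. -/
noncomputable def prodSubst : MvPolynomial (Fin 3) ℂ →ₐ[ℂ] MvPolynomial Var ℂ :=
  aeval fun i => X (i, 0) * X (i, 1)

/-- The exponent vector of a balanced monomial, read on the first column. -/
noncomputable def half (d : Var →₀ ℕ) : Fin 3 →₀ ℕ :=
  Finsupp.equivFunOnFinite.symm fun i => d (i, 0)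

/-- `half d i = d (i, 0)`. -/
theorem half_apply (d : Var →₀ ℕ) (i : Fin 3) : half d i = d (i, 0) := rfl

/-- `prodSubst` sends the monomial `Z^{half d}` to the balanced monomial `X^d`. -/
theorem prodSubst_monomial_balanced (d : Var →₀ ℕ) (hbal : ∀ i, d (i, 0) = d (i, 1)) (c : ℂ) :
    prodSubst (monomial (half d) c) = monomial d c := by
  rw [prodSubst, aeval_monomial, monomial_eq, algebraMap_eq]
  congr 1
  rw [Finsupp.prod_fintype _ _ (fun _ => pow_zero _), Finsupp.prod_fintype _ _ (fun _ => pow_zero _),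
    Fintype.prod_prod_type]
  apply Finset.prod_congr rfl
  intro i _
  rw [Fin.prod_univ_two, mul_pow, half_apply, ← hbal i]

/-- **Torus step.** A polynomial invariant under the diagonal unitaries is a polynomial in the
three products `X(i,0) X(i,1)`. -/
theorem exists_balanced_of_torus (f : MvPolynomial Var ℂ)
    (hf : ∀ t : Fin 3 → ℂ, (∀ i, t i * star (t i) = 1) → unitaryAct (Matrix.diagonal t) f = f) :
    ∃ F : MvPolynomial (Fin 3) ℂ, prodSubst F = f := by
  refine ⟨∑ d ∈ f.support, monomial (half d) (coeff d f), ?_⟩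
  rw [map_sum]
  conv_rhs => rw [as_sum f]
  apply Finset.sum_congr rfl
  intro d hd
  exact prodSubst_monomial_balanced d (fun i => balanced_of_torus f hf d (mem_support_iff.1 hd) i) _

/-! ## 3. Evaluation at points: the action on points, `prodSubst` at points -/

/-- The action of `u` on points: `eval x (unitaryAct u f) = eval (pointAct u x) f`. -/
def pointAct (u : Matrix (Fin 3) (Fin 3) ℂ) (x : Var → ℂ) : Var → ℂ :=
  fun p => if p.2 = 0 then ∑ j, star (u j p.1) * x (j, 0) else ∑ j, u j p.1 * x (j, 1)

/-- `eval x (unitaryAct u f) = eval (pointAct u x) f`. -/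
theorem eval_unitaryAct (u : Matrix (Fin 3) (Fin 3) ℂ) (x : Var → ℂ) (f : MvPolynomial Var ℂ) :
    eval x (unitaryAct u f) = eval (pointAct u x) f := by
  unfold unitaryAct
  rw [aeval_eq_bind₁]
  change aeval x _ = aeval (pointAct u x) f
  rw [aeval_bind₁]
  congr 2
  funext p
  simp only [pointAct]
  split_ifs <;> simp

/-- The products `zᵢ = x(i,0) x(i,1)` of a point. -/
def prodPt (x : Var → ℂ) : Fin 3 → ℂ := fun i => x (i, 0) * x (i, 1)

/-- `eval x (prodSubst F) = F̂(prodPt x)`. -/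
theorem eval_prodSubst (x : Var → ℂ) (F : MvPolynomial (Fin 3) ℂ) : eval x (prodSubst F) = eval (prodPt x) F := by
  rw [prodSubst, aeval_eq_bind₁]
  change aeval x _ = aeval (prodPt x) F
  rw [aeval_bind₁]
  congr 2
  funext i
  simp [prodPt]

/-- `eval x Q = z₀ + z₁ + z₂`. -/
theorem eval_Q (x : Var → ℂ) : eval x Q = prodPt x 0 + prodPt x 1 + prodPt x 2 := by
  simp [Q, prodPt, Fin.sum_univ_three]

/-! ## 4. The mixing unitary and the transposition -/

/-- The Gaussian mixing unitary `½ !![1+i, 1−i; 1−i, 1+i] ⊕ 1`. -/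
noncomputable def mixing : Matrix (Fin 3) (Fin 3) ℂ :=
  !![(1 + Complex.I) / 2, (1 - Complex.I) / 2, 0;
     (1 - Complex.I) / 2, (1 + Complex.I) / 2, 0;
     0, 0, 1]

/-- `mixing` is unitary. -/
theorem mixing_unitary : mixing * mixingᴴ = 1 := by
  ext i j
  fin_cases i <;> fin_cases j <;>
    simp [mixing, Matrix.mul_apply, Fin.sum_univ_three, Matrix.conjTranspose_apply,
      map_div₀, Complex.conj_I, map_ofNat] <;> ring_nf <;> simp [Complex.I_sq] <;> norm_num

/-- The transposition `(1 2)`. -/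
def swap12 : Matrix (Fin 3) (Fin 3) ℂ := !![1, 0, 0; 0, 0, 1; 0, 1, 0]

/-- `swap12` is unitary. -/
theorem swap12_unitary : swap12 * swap12ᴴ = 1 := by
  ext i j
  fin_cases i <;> fin_cases j <;>
    simp [swap12, Matrix.mul_apply, Fin.sum_univ_three, Matrix.conjTranspose_apply]

/-- The mixing unitary on the products of a point with `x(1,0) x(0,1) = x(0,0) x(1,1)`:
`z ↦ (½(z₀+z₁), ½(z₀+z₁), z₂)`. -/
theorem prodPt_mixing (x : Var → ℂ) (hy : x (1, 0) * x (0, 1) = x (0, 0) * x (1, 1)) :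
    prodPt (pointAct mixing x) =
      ![(prodPt x 0 + prodPt x 1) / 2, (prodPt x 0 + prodPt x 1) / 2, prodPt x 2] := by
  funext i
  fin_cases i
  · simp [prodPt, pointAct, mixing, Fin.sum_univ_three, map_div₀, Complex.conj_I, map_ofNat]
    linear_combination (Complex.I / 2) * hy + ((-(x (0, 0) * x (0, 1)) + x (0, 0) * x (1, 1) +
      x (1, 0) * x (0, 1) - x (1, 0) * x (1, 1)) / 4) * Complex.I_sq
  · simp [prodPt, pointAct, mixing, Fin.sum_univ_three, map_div₀, Complex.conj_I, map_ofNat]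
    linear_combination (-(Complex.I / 2)) * hy + ((-(x (0, 0) * x (0, 1)) + x (0, 0) * x (1, 1) +
      x (1, 0) * x (0, 1) - x (1, 0) * x (1, 1)) / 4) * Complex.I_sq
  · simp [prodPt, pointAct, mixing, Fin.sum_univ_three]

/-- The transposition on the products of a point: `z ↦ (z₀, z₂, z₁)`. -/
theorem prodPt_swap12 (x : Var → ℂ) :
    prodPt (pointAct swap12 x) = ![prodPt x 0, prodPt x 2, prodPt x 1] := by
  funext i
  fin_cases i <;> simp [prodPt, pointAct, swap12, Fin.sum_univ_three]

/-- Every triple `w` is the product vector of a point with `x(1,0) x(0,1) = x(0,0) x(1,1)`. -/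
theorem exists_point (w : Fin 3 → ℂ) :
    ∃ x : Var → ℂ, prodPt x = w ∧ x (1, 0) * x (0, 1) = x (0, 0) * x (1, 1) := by
  by_cases h0 : w 0 = 0
  · refine ⟨fun p => if p.1 = 0 then 0 else if p.1 = 1 then (if p.2 = 0 then 1 else w 1)
      else (if p.2 = 0 then 1 else w 2), ?_, ?_⟩
    · funext i
      fin_cases i <;> simp [prodPt, h0]
    · simp
  · obtain ⟨s, hs⟩ := IsAlgClosed.exists_eq_mul_self (w 1 / w 0)
    refine ⟨fun p => if p.1 = 0 then (if p.2 = 0 then 1 else w 0)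
      else if p.1 = 1 then (if p.2 = 0 then s else s * w 0)
      else (if p.2 = 0 then 1 else w 2), ?_, ?_⟩
    · funext i
      fin_cases i <;> simp [prodPt]
      calc s * (s * w 0) = (s * s) * w 0 := by ring
        _ = w 1 := by rw [← hs]; field_simp
    · simp

/-- Every triple `w` is the product vector of a point (for the transposition). -/
theorem exists_point' (w : Fin 3 → ℂ) : ∃ x : Var → ℂ, prodPt x = w :=
  ⟨fun p => if p.2 = 0 then 1 else w p.1, by funext i; simp [prodPt]⟩

/-! ## 5. The two functional identities and the theorem -/

/-- **Mixing.** If `prodSubst F` is fixed by the mixing unitary then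
`F̂(w₀, w₁, w₂) = F̂(½(w₀+w₁), ½(w₀+w₁), w₂)`. -/
theorem eval_mixing (F : MvPolynomial (Fin 3) ℂ) (hF : unitaryAct mixing (prodSubst F) = prodSubst F)
    (w : Fin 3 → ℂ) : eval w F = eval ![(w 0 + w 1) / 2, (w 0 + w 1) / 2, w 2] F := by
  obtain ⟨x, hx, hy⟩ := exists_point w
  have h1 : eval x (prodSubst F) = eval w F := by rw [eval_prodSubst, hx]
  have h2 : eval x (unitaryAct mixing (prodSubst F)) =
      eval ![(w 0 + w 1) / 2, (w 0 + w 1) / 2, w 2] F := by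
    rw [eval_unitaryAct, eval_prodSubst, prodPt_mixing x hy, hx]
  rw [← h1, ← h2, hF]

/-- **Transposition.** If `prodSubst F` is fixed by `(1 2)` then `F̂(w₀, w₁, w₂) = F̂(w₀, w₂, w₁)`. -/
theorem eval_swap (F : MvPolynomial (Fin 3) ℂ) (hF : unitaryAct swap12 (prodSubst F) = prodSubst F)
    (w : Fin 3 → ℂ) : eval w F = eval ![w 0, w 2, w 1] F := by
  obtain ⟨x, hx⟩ := exists_point' w
  have h1 : eval x (prodSubst F) = eval w F := by rw [eval_prodSubst, hx]
  have h2 : eval x (unitaryAct swap12 (prodSubst F)) = eval ![w 0, w 2, w 1] F := by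
    rw [eval_unitaryAct, eval_prodSubst, prodPt_swap12 x, hx]
  rw [← h1, ← h2, hF]

/-- From mixing and transposition: `F̂(w) = F̂(s/2, s/2, 0)` with `s = w₀ + w₁ + w₂`. -/
theorem eval_eq_eval_sum (F : MvPolynomial (Fin 3) ℂ) (hmix : unitaryAct mixing (prodSubst F) = prodSubst F)
    (hswap : unitaryAct swap12 (prodSubst F) = prodSubst F) (w : Fin 3 → ℂ) :
    eval w F = eval ![(w 0 + w 1 + w 2) / 2, (w 0 + w 1 + w 2) / 2, 0] F := by
  have e1 := eval_mixing F hmix w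
  have e2 := eval_mixing F hmix ![w 0 + w 1, 0, w 2]
  have e3 := eval_swap F hswap ![w 0 + w 1, 0, w 2]
  have e4 := eval_mixing F hmix ![w 0 + w 1, w 2, 0]
  simp only [Matrix.cons_val_zero, Matrix.cons_val_one, Matrix.cons_val_two, Matrix.tail_cons,
    Matrix.head_cons, add_zero] at e2 e3 e4
  rw [e1, ← e2, e3, e4]

/-- **First fundamental theorem for `U(3)` on `ℂ[Var]` (hard half).** A polynomial fixed by every
unitary `u` (`u uᴴ = 1`) is a polynomial in `Q = ∑ᵢ X(i,0) X(i,1)`. -/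
theorem invariant_eq_aeval_Q (f : MvPolynomial Var ℂ)
    (hf : ∀ u : Matrix (Fin 3) (Fin 3) ℂ, u * uᴴ = 1 → unitaryAct u f = f) :
    ∃ P : Polynomial ℂ, f = Polynomial.aeval Q P := by
  obtain ⟨F, rfl⟩ := exists_balanced_of_torus f (fun t ht => hf _ (diagonal_unitary t ht))
  have hmix := hf _ mixing_unitary
  have hswap := hf _ swap12_unitary
  set g : Fin 3 → Polynomial ℂ := fun i => if i = 2 then 0 else Polynomial.C (1 / 2 : ℂ) * Polynomial.X
    with hg
  refine ⟨aeval g F, ?_⟩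
  apply MvPolynomial.funext
  intro x
  have h1 : eval x (Polynomial.aeval Q (aeval g F)) = Polynomial.aeval (eval x Q) (aeval g F) := by
    change aeval x (Polynomial.aeval Q (aeval g F)) = Polynomial.aeval (aeval x Q) (aeval g F)
    exact (Polynomial.aeval_algHom_apply (aeval x) Q (aeval g F)).symm
  have h2 : Polynomial.aeval (eval x Q) (aeval g F) =
      eval (fun i => Polynomial.aeval (eval x Q) (g i)) F := by
    rw [← AlgHom.comp_apply, MvPolynomial.comp_aeval, aeval_eq_eval]
  have h3 : (fun i => Polynomial.aeval (eval x Q) (g i)) =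
      ![(prodPt x 0 + prodPt x 1 + prodPt x 2) / 2, (prodPt x 0 + prodPt x 1 + prodPt x 2) / 2, 0] := by
    funext i
    fin_cases i <;> simp [hg, eval_Q, div_eq_inv_mul]
  rw [eval_prodSubst, h1, h2, h3]
  exact eval_eq_eval_sum F hmix hswap (prodPt x)


/-! ## 6. Both halves (v2, appended): the invariants are exactly `ℂ[Q] = Algebra.adjoin ℂ {Q}` -/

/-- The easy half in the same form: every polynomial in `Q` is `U(3)`-invariant
(`T5FockWeights.unitaryAct_Q`). -/
theorem aeval_Q_invariant (P : Polynomial ℂ) (u : Matrix (Fin 3) (Fin 3) ℂ) (hu : u * uᴴ = 1) :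
    unitaryAct u (Polynomial.aeval Q P) = Polynomial.aeval Q P := by
  rw [← Polynomial.aeval_algHom_apply, unitaryAct_Q u hu]

/-- **First fundamental theorem for `U(3)` on `ℂ[Var]`, both halves.** `f` is fixed by every
unitary `u` iff `f` is a polynomial in `Q`. -/
theorem invariant_iff (f : MvPolynomial Var ℂ) :
    (∀ u : Matrix (Fin 3) (Fin 3) ℂ, u * uᴴ = 1 → unitaryAct u f = f) ↔
      ∃ P : Polynomial ℂ, f = Polynomial.aeval Q P :=
  ⟨invariant_eq_aeval_Q f, fun ⟨P, hP⟩ u hu => hP ▸ aeval_Q_invariant P u hu⟩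

/-- The `Algebra.adjoin` form: the `U(3)`-invariants are `Algebra.adjoin ℂ {Q}`. -/
theorem invariant_iff_mem_adjoin (f : MvPolynomial Var ℂ) :
    (∀ u : Matrix (Fin 3) (Fin 3) ℂ, u * uᴴ = 1 → unitaryAct u f = f) ↔
      f ∈ Algebra.adjoin ℂ {Q} := by
  rw [invariant_iff, Algebra.adjoin_singleton_eq_range_aeval]
  constructor
  · rintro ⟨P, rfl⟩; exact ⟨P, rfl⟩
  · rintro ⟨P, hP⟩; exact ⟨P, hP.symm⟩

end Summit.Ventures.HodgeRepro2.T5FockFFT
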